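import Mathlib
import HarnessLib
import Summits.HubbardSuperconductivity.HubbardSuperconductivity.Theorems.KLProgrammeKLRegimeSplitGenericV4

/-!
# Route `KLProgramme` — generic children of crux K3 `KLRegimeTwoPointLimit` (stmt-HubbardSuperconductivity-19937):
# the frame-class slot `Pr.frameOK` is read ANTITONICALLY by four of the five children — transport under a STRENGTHENED frame class

Cell `gate-hubbard-kl`, seat p2 (g9, bundle typist).  Context: plan g14 (R12) judges p1b's Δ25 candidate F2 ((E3c) at scale `0` is false for
lattice-invisible frame perturbations; memo `SCALE0-TWOLEG-EXPORTS.md`, evidence on 19918) and its repair menu, whose preferred item (R-deg) adds a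
DEGREE clause to the admissible frames.  This module records, once and for every bundle, how the five generic children of record
(`EngineP4 | BetaSplitP | CountertermP2 | VolumeLimitP2 | TwoPointAssemblyP3`, `…SplitGeneric`/`V3`/`V4`) depend on the frame-class slot:

* `HistP` and `TowerP` do not read `Pr.frameOK` at all (`histP_iff_of_slots`, `towerP_iff_of_slots`: they agree for two bundles with the same
  `split / renorm / engine / twoLeg` slots);
* `EngineP4`, `BetaSplitP`, `VolumeLimitP2` read `Pr.frameOK` only as a HYPOTHESIS and `TwoPointAssemblyP3` only inside its ∃-hypothesis, so all
  four are ANTITONE in that slot: if `Pr'` has the same four per-scale slots as `Pr` and a STRONGER frame class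
  (`∀ R U N μ K, Pr'.frameOK R U N μ K → Pr.frameOK R U N μ K`), then each of these children for `Pr` gives the same child for `Pr'`
  (`engineP4_anti_frameOK`, `betaSplitP_anti_frameOK`, `volumeLimitP2_anti_frameOK`, `twoPointAssemblyP3_anti_frameOK`);
* `CountertermP2` reads the slot in BOTH polarities (its volume-uniform hypothesis block ranges over admissible frames AND it must PRODUCE an
  admissible frame), so it does not transport: under a strengthened frame class child 2 is re-proved (its produced frame must be certified in the
  new class).  Nothing is stated for it here.

Consequence for a bundle that differs from a closed one ONLY by a stronger frame class (e.g. a degree clause): children 1, 4, 5 and the glue close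
from the old bundle's theorems by these one-liners; the engine child of the new bundle is WEAKER than the old one (more hypotheses); child 2 is the
one genuine re-close.  Proofs only (no definitions); nothing about the Hubbard model is asserted; nothing asserts superconductivity.
-/

noncomputable section

namespace Summit.HubbardSuperconductivity.HubbardSuperconductivity.Theorems.KLRegimeSplit

set_option linter.dupNamespace false -- summit = problem name (single-conjunct summit), D-0017

open Literature.MathematicalPhysics.QuantumLattice Literature.Probability.LatticeModels

section Slots

variable {Pr Pr' : Preds}

/-! ## §1 `HistP` and `TowerP` do not read the frame class -/

/-- Two bundles with the same `split / renorm / engine / twoLeg` slots have the same history predicate (the frame class is not read). -/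
theorem histP_iff_of_slots (hsplit : Pr'.split = Pr.split) (hren : Pr'.renorm = Pr.renorm) (heng : Pr'.engine = Pr.engine)
    (htwo : Pr'.twoLeg = Pr.twoLeg) (L M : ℕ) [NeZero L] [NeZero M] (G : GeoConsts) (P : SplitConsts) (Q : EngConsts)
    (R : RenConsts) (β U μ : ℝ) (K : TrigPolyC4v) (n : ℕ) :
    HistP Pr' L M G P Q R β U μ K n ↔ HistP Pr L M G P Q R β U μ K n := by
  unfold HistP
  rw [hsplit, hren, heng, htwo]

/-- Two bundles with the same `split / renorm / engine / twoLeg` slots have the same full tower (the frame class is not read). -/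
theorem towerP_iff_of_slots (hsplit : Pr'.split = Pr.split) (hren : Pr'.renorm = Pr.renorm) (heng : Pr'.engine = Pr.engine)
    (htwo : Pr'.twoLeg = Pr.twoLeg) (G : GeoConsts) (P : SplitConsts) (Q : EngConsts) (R : RenConsts) (β U μ : ℝ)
    (K : TrigPolyC4v) (Lstar : ℕ) (Mstar : ℕ → ℕ) :
    TowerP Pr' G P Q R β U μ K Lstar Mstar ↔ TowerP Pr G P Q R β U μ K Lstar Mstar := by
  unfold TowerP
  rw [hsplit, hren, heng, htwo]

/-! ## §2 The four antitone children -/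

/-- **`EngineP4` is antitone in the frame class**: the engine child for `Pr` gives the engine child for any bundle `Pr'` with the same
per-scale slots and a stronger frame class (fewer admissible frames ⇒ fewer obligations). -/
theorem engineP4_anti_frameOK {W : Set ℝ}
    (hF : ∀ (R : RenConsts) (U : ℝ) (N : ℕ) (μ : ℝ) (K : TrigPolyC4v), Pr'.frameOK R U N μ K → Pr.frameOK R U N μ K)
    (hsplit : Pr'.split = Pr.split) (hren : Pr'.renorm = Pr.renorm) (heng : Pr'.engine = Pr.engine)
    (htwo : Pr'.twoLeg = Pr.twoLeg) (h : EngineP4 Pr W) : EngineP4 Pr' W := by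
  obtain ⟨G, hG, hGP⟩ := h
  refine ⟨G, hG, fun P hP R hR => ?_⟩
  obtain ⟨Q, hQ, c₃, hc₃, hc⟩ := hGP P hP R hR
  refine ⟨Q, hQ, c₃, hc₃, fun c hc0 hcc => ?_⟩
  obtain ⟨U₀, hU₀, L₃, M₃, hmain⟩ := hc c hc0 hcc
  refine ⟨U₀, hU₀, L₃, M₃, fun μ hμ U hU hUle β hβ hβc K hK L M _ _ hL hM n hn hreg hhist => ?_⟩
  rw [heng, htwo]
  exact hmain μ hμ U hU hUle β hβ hβc K (hF _ _ _ _ _ hK) L M hL hM n hn hreg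
    ((histP_iff_of_slots hsplit hren heng htwo L M G P Q R β U μ K n).1 hhist)

/-- **`BetaSplitP` is antitone in the frame class.** -/
theorem betaSplitP_anti_frameOK {W : Set ℝ}
    (hF : ∀ (R : RenConsts) (U : ℝ) (N : ℕ) (μ : ℝ) (K : TrigPolyC4v), Pr'.frameOK R U N μ K → Pr.frameOK R U N μ K)
    (hsplit : Pr'.split = Pr.split) (hren : Pr'.renorm = Pr.renorm) (heng : Pr'.engine = Pr.engine)
    (htwo : Pr'.twoLeg = Pr.twoLeg) (h : BetaSplitP Pr W) : BetaSplitP Pr' W := by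
  intro G hG
  obtain ⟨P, hP, hPQ⟩ := h G hG
  refine ⟨P, hP, fun Q hQ => ?_⟩
  obtain ⟨c₀, hc₀, hc⟩ := hPQ Q hQ
  refine ⟨c₀, hc₀, fun c hc0 hcc R hR => ?_⟩
  obtain ⟨U₀, hU₀, L₁, M₁, hmain⟩ := hc c hc0 hcc R hR
  refine ⟨U₀, hU₀, L₁, M₁, fun μ hμ U hU hUle β hβ hβc K hK L M _ _ hL hM n hn hreg hhist heng' htwo' => ?_⟩
  rw [hsplit]
  rw [heng] at heng'
  rw [htwo] at htwo'
  exact hmain μ hμ U hU hUle β hβ hβc K (hF _ _ _ _ _ hK) L M hL hM n hn hreg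
    ((histP_iff_of_slots hsplit hren heng htwo L M G P Q R β U μ K n).1 hhist) heng' htwo'

/-- **`VolumeLimitP2` is antitone in the frame class** (any volume-limit slot `VL`). -/
theorem volumeLimitP2_anti_frameOK {VL : VolLimitSlot} {W : Set ℝ}
    (hF : ∀ (R : RenConsts) (U : ℝ) (N : ℕ) (μ : ℝ) (K : TrigPolyC4v), Pr'.frameOK R U N μ K → Pr.frameOK R U N μ K)
    (hsplit : Pr'.split = Pr.split) (hren : Pr'.renorm = Pr.renorm) (heng : Pr'.engine = Pr.engine)
    (htwo : Pr'.twoLeg = Pr.twoLeg) (h : VolumeLimitP2 Pr VL W) : VolumeLimitP2 Pr' VL W := by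
  intro G P Q R hG hP hQ hR
  obtain ⟨c₅, hc₅, hc⟩ := h G P Q R hG hP hQ hR
  refine ⟨c₅, hc₅, fun c hc0 hcc => ?_⟩
  obtain ⟨U₀, hU₀, hmain⟩ := hc c hc0 hcc
  refine ⟨U₀, hU₀, fun μ hμ U hU hUle β hβ hβc K hK Lstar Mstar htower => ?_⟩
  exact hmain μ hμ U hU hUle β hβ hβc K (hF _ _ _ _ _ hK) Lstar Mstar
    ((towerP_iff_of_slots hsplit hren heng htwo G P Q R β U μ K Lstar Mstar).1 htower)

/-- **`TwoPointAssemblyP3` is antitone in the frame class** (any volume-limit slot `VL`). -/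
theorem twoPointAssemblyP3_anti_frameOK {VL : VolLimitSlot} {W : Set ℝ}
    (hF : ∀ (R : RenConsts) (U : ℝ) (N : ℕ) (μ : ℝ) (K : TrigPolyC4v), Pr'.frameOK R U N μ K → Pr.frameOK R U N μ K)
    (hsplit : Pr'.split = Pr.split) (hren : Pr'.renorm = Pr.renorm) (heng : Pr'.engine = Pr.engine)
    (htwo : Pr'.twoLeg = Pr.twoLeg) (h : TwoPointAssemblyP3 Pr VL W) : TwoPointAssemblyP3 Pr' VL W := by
  intro G P Q R hG hP hQ hR c hc
  obtain ⟨U₀, hU₀, hmain⟩ := h G P Q R hG hP hQ hR c hc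
  refine ⟨U₀, hU₀, fun μ hμ U hU hUle β hβ hβc Lstar Mstar hex x y σ σ' => ?_⟩
  obtain ⟨K, hK, htower, hVL⟩ := hex
  exact hmain μ hμ U hU hUle β hβ hβc Lstar Mstar
    ⟨K, hF _ _ _ _ _ hK, (towerP_iff_of_slots hsplit hren heng htwo G P Q R β U μ K Lstar Mstar).1 htower, hVL⟩ x y σ σ'

end Slots

/-! ## §3 The `{ Pr with frameOK := F }` form -/

section With

variable (Pr : Preds) (F : RenConsts → ℝ → ℕ → ℝ → TrigPolyC4v → Prop)

/-- `EngineP4` for `Pr` gives `EngineP4` for `Pr` with its frame class replaced by a stronger one. -/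
theorem engineP4_withFrameOK {W : Set ℝ}
    (hF : ∀ (R : RenConsts) (U : ℝ) (N : ℕ) (μ : ℝ) (K : TrigPolyC4v), F R U N μ K → Pr.frameOK R U N μ K)
    (h : EngineP4 Pr W) : EngineP4 { Pr with frameOK := F } W :=
  engineP4_anti_frameOK (Pr := Pr) (Pr' := { Pr with frameOK := F }) hF rfl rfl rfl rfl h

/-- `BetaSplitP` for `Pr` gives `BetaSplitP` for `Pr` with its frame class replaced by a stronger one. -/
theorem betaSplitP_withFrameOK {W : Set ℝ}
    (hF : ∀ (R : RenConsts) (U : ℝ) (N : ℕ) (μ : ℝ) (K : TrigPolyC4v), F R U N μ K → Pr.frameOK R U N μ K)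
    (h : BetaSplitP Pr W) : BetaSplitP { Pr with frameOK := F } W :=
  betaSplitP_anti_frameOK (Pr := Pr) (Pr' := { Pr with frameOK := F }) hF rfl rfl rfl rfl h

/-- `VolumeLimitP2` for `Pr` gives `VolumeLimitP2` for `Pr` with its frame class replaced by a stronger one. -/
theorem volumeLimitP2_withFrameOK {VL : VolLimitSlot} {W : Set ℝ}
    (hF : ∀ (R : RenConsts) (U : ℝ) (N : ℕ) (μ : ℝ) (K : TrigPolyC4v), F R U N μ K → Pr.frameOK R U N μ K)
    (h : VolumeLimitP2 Pr VL W) : VolumeLimitP2 { Pr with frameOK := F } VL W :=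
  volumeLimitP2_anti_frameOK (Pr := Pr) (Pr' := { Pr with frameOK := F }) hF rfl rfl rfl rfl h

/-- `TwoPointAssemblyP3` for `Pr` gives `TwoPointAssemblyP3` for `Pr` with its frame class replaced by a stronger one. -/
theorem twoPointAssemblyP3_withFrameOK {VL : VolLimitSlot} {W : Set ℝ}
    (hF : ∀ (R : RenConsts) (U : ℝ) (N : ℕ) (μ : ℝ) (K : TrigPolyC4v), F R U N μ K → Pr.frameOK R U N μ K)
    (h : TwoPointAssemblyP3 Pr VL W) : TwoPointAssemblyP3 { Pr with frameOK := F } VL W :=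
  twoPointAssemblyP3_anti_frameOK (Pr := Pr) (Pr' := { Pr with frameOK := F }) hF rfl rfl rfl rfl h

end With

end Summit.HubbardSuperconductivity.HubbardSuperconductivity.Theorems.KLRegimeSplit

end
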